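import Summits.Parity.GeneralizedHardyLittlewood.Theses.LeeYangFibres
import Summits.Parity.GeneralizedHardyLittlewood.Theorems.LeeYangFibresRelativeDimOneTypeClassMoments
import Summits.Parity.GeneralizedHardyLittlewood.Theorems.LeeYangFibresRelativeDimOneTypeRigidity
import Summits.Parity.GeneralizedHardyLittlewood.Theorems.LeeYangFibresRelativeDimOneTypeSingularWeights
import Summits.Parity.GeneralizedHardyLittlewood.Theorems.LeeYangFibresRelativeDimOneTypeData
import Summits.Parity.GeneralizedHardyLittlewood.Theorems.LeeYangFibresRelativeDimOneTypeEndgame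
import Summits.Parity.GeneralizedHardyLittlewood.Theorems.LeeYangFibresRelativeDimOneSplitBandlimited
import Summits.Parity.GeneralizedHardyLittlewood.Theorems.LeeYangFibresRelativeDimOneLatticeNecessity
import Summits.Parity.GeneralizedHardyLittlewood.Theorems.LeeYangFibresRelativeDimOneHardness
import Summits.Parity.GeneralizedHardyLittlewood.Theorems.LeeYangFibresCellParityLawSingularRatio
import Summits.Parity.GeneralizedHardyLittlewood.Theorems.LeeYangFibresAbsoluteUpgradeSlices
import Summits.Parity.GeneralizedHardyLittlewood.Theorems.RelativeDimOne.Negative.RelativeDimOneLoadBearing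
import Summits.Parity.GeneralizedHardyLittlewood.Theorems.RelativeDimOne.Negative.RelativeDimOneLoadBearingTwo
import Summits.Parity.GeneralizedHardyLittlewood.Theorems.RelativeDimOne.Negative.RelativeDimOneRepeatedForm
import Summits.Parity.GeneralizedHardyLittlewood.Theorems.RelativeDimOne.Negative.RelativeDimOneLogSlack
import HarnessLib

/-!
# Line `gallagher-backwards-split` — RESHAPED skeleton for the crux `RelativeDimOne` (stmt-Parity-14113):
# the TYPE-CONDITIONED split  crux ⟸ (incidence-bandlimited core with HL decay, level N^{1/4}) ∧ (class second moment, level N^{1/3})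

Route `LeeYangFibres` (Parity / GeneralizedHardyLittlewood); crux decl
`Summit.Parity.GeneralizedHardyLittlewood.Theses.LeeYangFibres.RelativeDimOne`. Lead seat c1
(`prover-line-stmt-Parity-14113-c1-0`), 2026-08-16, reshape of the skeleton of `planner-cruxplan-…-gallagher-backwards--0` /
lead `prover-line-stmt-Parity-14113-1` (same slug, same composition idea, same two atoms up to the decay clause).

## Why the reshape (evidence `Cruxes/RelativeDimOne/StubRigidityFalse-c1.md`, commit c03ddcce3628)

The original line factored the inversion through `stub_rigidity : IncidenceRigidity (1/4) (3/10)`, which is FALSE: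
(F2) an explicit product/Chebyshev incidence spectrum over `O(log 1/η)` tiny prime classes has every box-coset average
`≤ η`, the a-priori bound with `C = 1`, and `E(2) = 1`; (F1) even inside the Hardy–Littlewood decay class the
`η (q/φ(q))^{t+1}` normalisation of the residue-coset data (A) is too weak at primorial-like moduli. The composition idea
survives with two forced repairs, typed in `Theorems/LeeYangFibresRelativeDimOneTypeDefs.lean`:
* the core spectrum carries HARDY–LITTLEWOOD DECAY (`IncidenceBandlimitedCoreDecay`; still necessary for the crux —
  `coreDecay_of_relativeDimOne` below, sorry-free);
* the lattice data are TYPE-CELL averages (shifts whose incidence types agree with the target's at all primes `≤ w`),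
  not residue-coset sums: slack-free, and deliverable for EVERY `t` from the class second moment because over a type
  cell the one-deviation terms of the multilinear expansion collapse to the global prime number theorem
  (`TypeClassMoments`), while the pointwise extraction (`TypeRigidity`) is the `t`-tuple version of the landed pair
  theorems `pairRigidityWithDecay` (p109047) / `pairRigidityWeighted` (p112112).

## The line (7 registered stubs — 5 LANDED, 2 atoms open; composition `RelativeDimOne_of` is a real proof)

Atoms (OPEN; both provably NECESSARY for the crux, certificates at the end of this file):
* `stub_coreDecay : IncidenceBandlimitedCoreDecay (1/4)` — ATOM P′.
* `stub_lowSecondMoment : LowClassSecondMoment (1/3)` — ATOM L (unchanged).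
Provable:
* `stub_typeClassMoments` (L/XL): `LowClassSecondMoment θ₁ → TypeClassMoments θ₁'` (`θ₁' < θ₁ < 1`) — class variance at two
  heights (landed `classVariance_of_lowClassSecondMoment`), Brun–Titchmarsh (landed `classPsi_le_of_level`), PNT in
  windows, and the unit-scaling symmetry of type cells.
* `stub_typeRigidity` (L/XL, lead): `TypeRigidity` — CRT on type cells, mean weight `O(t³/p²)` at rough primes,
  `k ≤ log|Δ|/log w` rough discriminant primes.
* `stub_singularWeights` (M/L): `SingularWeightFacts` — (W1) `G_w ≤ C_t 𝔖`, (W2) local obstruction, (W4) smooth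
  truncation of the singular-series spectrum (Rankin), (W5) coprime density on a type class `=` local factor.
* `stub_typeData` (XL): `TypeClassMoments θ₁ → SingularWeightFacts → TypeRigidity → TypeData θ` — the dictionary summed
  over a type cell (landed `dictionary_identity`), residue counting modulo `∏_{p≤w} p · q ≤ N^{1/D+θ}`.
* `stub_endgame` (M/L): `Endgame θ` — quantifier plumbing + the landed uniform Euler tail `abs_sub_sum_squarefree_le`.

Disproof.lean (cdisprove, 09:46Z): NO KILL; its load-bearing witnesses are honoured (size, box, convexity,
non-degeneracy, `ε > 0`, threshold all kept in `IncidenceBandlimitedCoreDecay`/`CoreApprox`; `+εN` slack kept) — see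
`DisproofCompatibility` at the end.
-/

noncomputable section

open scoped BigOperators Classical Topology
open Finset Filter MeasureTheory Literature.NumberTheory.Sieve
open Summit.Parity.GeneralizedHardyLittlewood.Theses.LeeYangFibres (RelativeDimOne)
open Summit.Parity.GeneralizedHardyLittlewood.Cruxes.RelativeDimOne.GallagherBackwards
open Summit.Parity.GeneralizedHardyLittlewood.Cruxes.RelativeDimOne.GallagherBackwardsSplit
open Summit.Parity.GeneralizedHardyLittlewood.Cruxes.CellParityLaw.SectionAnnihilator.SingularRatio
  (singularProduct_nonneg)
open Summit.Parity.GeneralizedHardyLittlewood.Theorems.AbsoluteUpgrade (archFactor_le_two_mul)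

namespace Summit.Parity.GeneralizedHardyLittlewood.Cruxes.RelativeDimOne.TypeSplit

/-! ### The two atoms (the only remaining stubs) -/

/-- ATOM P′ (OPEN): the incidence-bandlimited core with Hardy–Littlewood decay at level `N^{1/4}`. -/
theorem stub_coreDecay : IncidenceBandlimitedCoreDecay (1 / 4) := by
  sorry

/-- ATOM L (OPEN, unchanged from the original skeleton): the sharp class second moment below level `N^{1/3}`. -/
theorem stub_lowSecondMoment : LowClassSecondMoment (1 / 3) := by
  sorry

/-! The five PROVABLE stubs are LANDED (imported): `stub_typeClassMoments` (…TypeClassMoments, p117562),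
`stub_typeRigidity` (…TypeRigidity), `stub_singularWeights` (…TypeSingularWeights, p119458), `stub_typeData` (…TypeData,
p119410), `stub_endgame` (…TypeEndgame, p116137). Only the two ATOMS above remain `sorry`. -/

/-! ### The composition -/

/-- **The crux from the stubs** (hypothesis form; concludes `LeeYangFibres.RelativeDimOne` BY NAME): core with decay at
level `1/4`, class second moment at level `1/3` feeding type-class moments at level `3/10`, rigidity, weights, type
data at level `1/4`, endgame. -/
theorem RelativeDimOne_of :
    IncidenceBandlimitedCoreDecay (1 / 4) → LowClassSecondMoment (1 / 3) →
    (∀ θ₁ θ₁' : ℝ, θ₁' < θ₁ → θ₁ < 1 → LowClassSecondMoment θ₁ → TypeClassMoments θ₁') →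
    TypeRigidity → SingularWeightFacts →
    (∀ θ θ₁ : ℝ, 0 < θ → θ < 1 → 0 < θ₁ →
      TypeClassMoments θ₁ → SingularWeightFacts → TypeRigidity → TypeData θ) →
    (∀ θ : ℝ, 0 < θ → θ < 1 → Endgame θ) → RelativeDimOne :=
  fun hP hL hMom hRig hW hData hEnd =>
    hEnd (1 / 4) (by norm_num) (by norm_num) hP
      (hData (1 / 4) (3 / 10) (by norm_num) (by norm_num) (by norm_num)
        (hMom (1 / 3) (3 / 10) (by norm_num) (by norm_num) hL) hW hRig)
      hRig hW

/-- The crux, modulo the seven registered stubs. -/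
theorem relativeDimOne_modulo_stubs : RelativeDimOne :=
  RelativeDimOne_of stub_coreDecay stub_lowSecondMoment stub_typeClassMoments stub_typeRigidity
    stub_singularWeights stub_typeData stub_endgame

/-! ### Sorry-free certificates: both atoms are NECESSARY for the crux -/

/-- Atom L is a restriction of the tree's `SharpClassSecondMoment`. -/
theorem lowClassSecondMoment_of_sharp {θ₁ : ℝ} (hθ : θ₁ ≤ 1) (h : SharpClassSecondMoment) :
    LowClassSecondMoment θ₁ := by
  intro ε hε
  obtain ⟨N₀, hN₀⟩ := h ε hε
  refine ⟨max N₀ 1, fun N hN q hq hqN => hN₀ N (le_of_max_le_left hN) q hq ?_⟩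
  have hN1 : (1 : ℝ) ≤ N := by exact_mod_cast le_of_max_le_right hN
  have hqR : (q : ℝ) ≤ N :=
    calc (q : ℝ) ≤ (N : ℝ) ^ θ₁ := hqN
      _ ≤ (N : ℝ) ^ (1 : ℝ) := Real.rpow_le_rpow_of_exponent_le hN1 hθ
      _ = N := Real.rpow_one _
  exact_mod_cast hqR

/-- **Atom L is necessary**: the crux implies the class second moment at every level `θ₁ ≤ 1` (Gallagher's identity
backwards, `latticeNecessity` p92797). -/
theorem lowClassSecondMoment_of_relativeDimOne {θ₁ : ℝ} (hθ : θ₁ ≤ 1) :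
    RelativeDimOne → LowClassSecondMoment θ₁ :=
  fun h => lowClassSecondMoment_of_sharp hθ (latticeNecessity (upperRelativeDimOne_of_relativeDimOne h))

/-- The squarefree band sum of the singular-series spectrum of `Ψ = sys a b` is the truncated squarefree Euler
expansion of `𝔖(Ψ)`. -/
theorem sfBand_hlCoeff {t : ℕ} (Q : ℕ) (Ψ : Fin t → AffLinForm 1) :
    sfBand Q (fun q b => hlCoeff q (coeffs Ψ) b) (consts Ψ) =
      ∑ q ∈ (Finset.Icc 1 Q).filter Squarefree, ∏ p ∈ q.primeFactors, (localFactor Ψ p - 1) := by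
  unfold sfBand hlCoeff
  simp only [sys_coeffs_consts]

open BandlimitedProof in
/-- **Atom P′ is necessary**: the crux gives the incidence-bandlimited core WITH DECAY at every level `θ > 0`, with the
singular-series spectrum `hlCoeff` (type-invariant, decay constant `1`) and the landed uniform Euler tail. -/
theorem coreDecay_of_relativeDimOne {θ : ℝ} (hθ : 0 < θ) (hR : RelativeDimOne) :
    IncidenceBandlimitedCoreDecay θ := by
  intro t L ht
  refine ⟨1, one_pos, fun ε hε => ?_⟩
  have hε₁ : (0 : ℝ) < min 1 (ε / 8) := lt_min one_pos (by linarith)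
  have hε₁1 : min 1 (ε / 8) ≤ 1 := min_le_left _ _
  have hε₁8 : min 1 (ε / 8) ≤ ε / 8 := min_le_right _ _
  have hε₂ : (0 : ℝ) < min 1 (ε / 4) := lt_min one_pos (by linarith)
  have hε₂1 : min 1 (ε / 4) ≤ 1 := min_le_left _ _
  have hε₂4 : min 1 (ε / 4) ≤ ε / 4 := min_le_right _ _
  obtain ⟨N₁, hN₁⟩ := abs_sub_sum_squarefree_le t L hθ hε₁
  obtain ⟨N₂, hN₂⟩ := hR t L ht (min 1 (ε / 4)) hε₂
  refine ⟨max N₁ N₂, fun N hN => ?_⟩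
  refine ⟨fun a q b => hlCoeff q a b, fun a => EndgameProof.typeInvariant_hl a, fun a => EndgameProof.hasDecay_hl a,
    fun Ψ hΨ hL K hK hKN => ?_⟩
  have hSG := ((hN₁ N (le_of_max_le_left hN)) Ψ hΨ hL).2
  rw [← sfBand_hlCoeff (level θ N) Ψ] at hSG
  have hS0 : 0 ≤ singularProduct Ψ := singularProduct_nonneg hΨ
  set G := sfBand (level θ N) (fun q b => hlCoeff q (coeffs Ψ) b) (consts Ψ) with hGdef
  set 𝔖 := singularProduct Ψ with h𝔖def
  have hGabs : |G| ≤ 𝔖 + min 1 (ε / 8) := by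
    have h1 : |G| - |𝔖| ≤ |G - 𝔖| := abs_sub_abs_le_abs_sub G 𝔖
    rw [abs_sub_comm] at h1
    rw [abs_of_nonneg hS0] at h1
    linarith
  have hSleG : 𝔖 ≤ |G| + min 1 (ε / 8) := by
    have h1 : |𝔖| - |G| ≤ |𝔖 - G| := abs_sub_abs_le_abs_sub 𝔖 G
    rw [abs_of_nonneg hS0] at h1
    linarith
  have hcrux := hN₂ N (le_of_max_le_right hN) Ψ hΨ hL K hK hKN
  have hA0 : 0 ≤ archFactor Ψ K := by
    unfold archFactor
    exact ENNReal.toReal_nonneg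
  have hA2 : archFactor Ψ K ≤ 2 * (N : ℝ) := archFactor_le_two_mul Ψ hKN
  set A := archFactor Ψ K with hAdef
  set S := vonMangoldtSum Ψ K N with hSdef
  have hN0 : (0 : ℝ) ≤ N := Nat.cast_nonneg N
  have hGa0 : 0 ≤ |G| := abs_nonneg G
  have h1 : |S - A * G| ≤ |S - A * 𝔖| + A * |𝔖 - G| := by
    have hsplit : S - A * G = (S - A * 𝔖) + A * (𝔖 - G) := by ring
    calc |S - A * G| = |(S - A * 𝔖) + A * (𝔖 - G)| := by rw [hsplit]
      _ ≤ |S - A * 𝔖| + |A * (𝔖 - G)| := abs_add_le _ _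
      _ = |S - A * 𝔖| + A * |𝔖 - G| := by rw [abs_mul, abs_of_nonneg hA0]
  have h2 : A * |𝔖 - G| ≤ A * min 1 (ε / 8) := mul_le_mul_of_nonneg_left hSG hA0
  have h3 : A * 𝔖 ≤ A * |G| + A * min 1 (ε / 8) := by
    have := mul_le_mul_of_nonneg_left hSleG hA0
    rw [mul_add] at this
    exact this
  have h4 : min 1 (ε / 4) * (A * 𝔖) ≤ min 1 (ε / 4) * (A * |G| + A * min 1 (ε / 8)) :=
    mul_le_mul_of_nonneg_left h3 hε₂.le
  have hX0 : 0 ≤ A * |G| := mul_nonneg hA0 hGa0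
  have h5 : min 1 (ε / 4) * (A * |G|) ≤ ε * (A * |G|) :=
    mul_le_mul_of_nonneg_right (hε₂4.trans (by linarith)) hX0
  have hY0 : 0 ≤ A * min 1 (ε / 8) := mul_nonneg hA0 hε₁.le
  have h6 : min 1 (ε / 4) * (A * min 1 (ε / 8)) ≤ 1 * (A * min 1 (ε / 8)) :=
    mul_le_mul_of_nonneg_right hε₂1 hY0
  have h7 : A * min 1 (ε / 8) ≤ 2 * (N : ℝ) * min 1 (ε / 8) :=
    mul_le_mul_of_nonneg_right hA2 hε₁.le
  have h8 : (N : ℝ) * min 1 (ε / 8) ≤ (N : ℝ) * (ε / 8) := mul_le_mul_of_nonneg_left hε₁8 hN0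
  have h9 : min 1 (ε / 4) * (N : ℝ) ≤ (ε / 4) * N := mul_le_mul_of_nonneg_right hε₂4 hN0
  have hc' : |S - A * 𝔖| ≤ min 1 (ε / 4) * (A * 𝔖) + min 1 (ε / 4) * N := by
    have := hcrux
    rw [mul_add] at this
    exact this
  calc |S - A * G| ≤ |S - A * 𝔖| + A * |𝔖 - G| := h1
    _ ≤ ε * (A * |G| + N) := by nlinarith [h2, h3, h4, h5, h6, h7, h8, h9, hc', hX0, hY0, hN0, hε.le]

/-! ### §Disproof — the landed Negative lemmas of this crux, checked against the reshaped stubs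

Each deleted hypothesis of the disprover's load-bearing witnesses is KEPT by the reshaped statements
(`CoreApprox`: `affLinSize Ψ N ≤ L`, `K ⊆ realBox 1 N`, `Convex ℝ K`, `IsNondegenerateSystem Ψ`; every `N₀` comes after
`L` and `ε`; the `+ εN` slack is kept). -/

section DisproofCompatibility
open Summit.Parity.GeneralizedHardyLittlewood.Theorems.RelativeDimOne.Negative

example : ¬ RelativeDimOneWithoutSize := relativeDimOne_false_without_size
example : ¬ RelativeDimOneWithoutBox := relativeDimOne_false_without_box
example : ¬ RelativeDimOneWithoutConvex := relativeDimOne_false_without_convex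
example : ¬ RelativeDimOneWithoutNondegenerate := relativeDimOne_false_without_nondegenerate
example : ¬ RelativeDimOneWithoutNonproportional := relativeDimOne_false_without_nonproportional
example : ¬ PurelyRelativeDimOne := not_purelyRelativeDimOne
example : ¬ RelativeDimOneLogSlack := not_relativeDimOneLogSlack
example : ¬ RelativeDimOneUniformInSize := not_relativeDimOneUniformInSize

end DisproofCompatibility

end Summit.Parity.GeneralizedHardyLittlewood.Cruxes.RelativeDimOne.TypeSplit

end
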